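import Literature.NumberTheory.EllipticCurves.Castella2024.LambdaAdicHeegnerClassExistence
import Summits.BirchSwinnertonDyer.BirchSwinnertonDyer.Theorems.UniversalToricDescentHeegnerNormTransversal
import Summits.BirchSwinnertonDyer.Rank1Residual.X11b.AnticyclotomicStrictDescent
import Literature.NumberTheory.EllipticCurves.GaloisActionProofs
import Literature.NumberTheory.EllipticCurves.SelmerProofs
import HarnessLib

/-!
# Route UniversalToricDescent — K1 at layer `k` propagates: the NORM of the layer-`n` Kummer class of a coherent Heegner
# family is locally non-zero at every layer `n ≥ k` (brick 4b of the port stub `stub_residualLinkMult`, line `beta-road` v5,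
# crux `TwinAlgMuZeroAtThree`, stmt-BirchSwinnertonDyer-24737)

Lead prover bsd-wall-utd-p1 g23 (`--supports stmt-BirchSwinnertonDyer-24737`). For a Heegner family `F` along a `ℤ_p`-extension
`κ` of a number field `K`, norm-coherent with sign `α`, `α² = 1` (`HeegnerFamily.IsNormCompatible F γ α`), a subgroup `D ≤ Γ_K`
(intended: the decomposition group of a prime above `p`) and layers `k ≤ n = k + m`:

* §1 Kummer plumbing: `kummerClassOver_sum` (the Kummer class of a sum of roots is the sum of the classes),
  `kummerClassOver_ne_zero_of_zsmul_sq_eq_one` (`δ(m•Q) ≠ 0`, `α² = 1`, `m•Q′ = α^j•(m•Q)` ⟹ `δ(m•Q′) ≠ 0`),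
  `continuous_smul_geomTorsion'` (orbit maps of `E[m]` are continuous).
* §2 **`resOfLe_sum_conjH1_kummerClassOver_ne_zero`** — if (K1) the Kummer class of `z_k` is non-zero on `Γ_{K_k} ∩ D` and
  (H0) `E[p]` has no non-zero point fixed by `Γ_{K_n} ∩ D`, then for any root `Q_n` of `z_n` (`p • Q_n = z_n`) the class
  `∑_{i<p^m} conj_{γ^{p^k i}} δ_{K_n}(Q_n) ∈ H¹(Γ_{K_n}, E[p])` — the NORM `N_{K_n/K_k}` applied to the layer-`n` Kummer class —
  restricts NON-TRIVIALLY to `Γ_{K_n} ∩ D`. Proof: `conj_σ δ(Q) = δ(σQ)` and additivity give `N δ(Q_n) = δ(∑ γ^{p^k i} Q_n)`,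
  whose `p`-multiple is `∑ γ^{p^k i} z_n = α^m z_k` (`…HeegnerNormTransversal.sum_transversal_smul_z`, p738164); root
  independence replaces the root by `α^m Q_k`; restriction to `Γ_{K_n} ∩ D` factors through `Γ_{K_k} ∩ D`, where the class is
  `≠ 0` by K1 and the sign trick, and `res : H¹(Γ_{K_k} ∩ D, E[p]) → H¹(Γ_{K_n} ∩ D, E[p])` is injective by
  inflation–restriction under (H0) (`X11b.AcSelmer.resOfLe_injective_of_fixedPoints`).

This is the input «`(∑_{i<p^m} φ^{p^k i}) u ≠ 0`» of `…ResidualNormSpan.succ_le_finrank_of_sum_pow_apply_ne_zero` (p737965) for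
the local signature of the Heegner class at layer `n`. THEOREMS ONLY (no definition, no named fact, no `sorry`). BSD is not advanced.
References: [BertoliniDarmon1996] §2.5 eq. (7); [SilvermanAEC2009] VIII.§2; [SerreGaloisCohomology1997] I.§2.6 (inflation–restriction).
-/

set_option linter.dupNamespace false
set_option autoImplicit false

noncomputable section

open scoped Classical
open Finset

namespace Summit.BirchSwinnertonDyer.BirchSwinnertonDyer.Theorems.UniversalToricDescentHeegnerLayerSignature

open Literature.NumberTheory.EllipticCurves WeierstrassCurve
open Summit.BirchSwinnertonDyer.BirchSwinnertonDyer.Theorems.UniversalToricDescentHeegnerNormTransversal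

/-! ## §1 Kummer plumbing -/

section Plumbing

variable {L : Type} [Field L] (V : WeierstrassCurve L) (H' : Subgroup (Field.absoluteGaloisGroup L))

/-- Congruence of Kummer classes in the root (proof-irrelevant rewriting helper). [folklore] -/
theorem kummerClassOver_congr (m : ℤ) {Q Q' : geomPoints V} (h : Q = Q')
    (hQ : ∀ σ ∈ H', σ • (m • Q) = m • Q) (hQ' : ∀ σ ∈ H', σ • (m • Q') = m • Q') :
    V.kummerClassOver H' m Q hQ = V.kummerClassOver H' m Q' hQ' := by
  subst h
  rfl

/-- **The Kummer class of a sum of roots is the sum of the Kummer classes.**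
[cite: SilvermanAEC2009, VIII.§2 (the Kummer pairing is bilinear)] -/
theorem kummerClassOver_sum (m : ℤ) {ι : Type*} (s : Finset ι) (Q : ι → geomPoints V)
    (hQ : ∀ i, ∀ σ ∈ H', σ • (m • Q i) = m • Q i) :
    ∑ i ∈ s, V.kummerClassOver H' m (Q i) (hQ i) =
      V.kummerClassOver H' m (∑ i ∈ s, Q i) (fun σ hσ ↦ by
        rw [Finset.smul_sum, Finset.smul_sum]
        exact Finset.sum_congr rfl fun i _ ↦ hQ i σ hσ) := by
  classical
  induction s using Finset.induction_on with
  | empty =>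
    have h0 : ∀ σ ∈ H', σ • (0 : geomPoints V) = 0 := fun σ _ ↦ smul_zero σ
    rw [Finset.sum_empty, eq_comm,
      kummerClassOver_congr V H' m Finset.sum_empty _ (fun σ hσ ↦ by rw [smul_zsmul_geomPoints, h0 σ hσ])]
    exact kummerClassOver_eq_zero_of_fixed V H' m 0 h0
  | insert a s ha ih =>
    rw [Finset.sum_insert ha, ih, ← kummerClassOver_add]
    exact kummerClassOver_congr V H' m (Finset.sum_insert ha).symm _ _

/-- **Sign trick**: `δ(m•Q) ≠ 0`, `α² = 1` and `m • Q′ = α^j • (m • Q)` ⟹ `δ(m•Q′) ≠ 0` (if `m•Q′ = m•R′` with `R′` fixed then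
`m•Q = m•(α^j • R′)` with `α^j • R′` fixed). [cite: SilvermanAEC2009, VIII.§2 (Prop. 2.1 setting)] -/
theorem kummerClassOver_ne_zero_of_zsmul_sq_eq_one (m : ℤ) {α : ℤ} (hα : α ^ 2 = 1) (j : ℕ)
    (Q Q' : geomPoints V) (hQ : ∀ σ ∈ H', σ • (m • Q) = m • Q) (hQ' : ∀ σ ∈ H', σ • (m • Q') = m • Q')
    (hne : V.kummerClassOver H' m Q hQ ≠ 0) (h : m • Q' = α ^ j • (m • Q)) :
    V.kummerClassOver H' m Q' hQ' ≠ 0 := by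
  intro h0
  apply hne
  obtain ⟨R, hRfix, hR⟩ := (kummerClassOver_eq_zero_iff (V := V) (H' := H') m Q' hQ').mp h0
  have hαα : α ^ j * α ^ j = 1 := by rw [← pow_two, ← pow_mul, mul_comm, pow_mul, hα, one_pow]
  refine (kummerClassOver_eq_zero_iff (V := V) (H' := H') m Q hQ).mpr ⟨α ^ j • R, fun σ hσ ↦ ?_, ?_⟩
  · rw [smul_zsmul_geomPoints, hRfix σ hσ]
  · rw [smul_comm, hR, h, smul_smul, hαα, one_smul]

end Plumbing

/-! ## §2 K1 propagates along the layers -/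

variable {K : Type} [Field K] [NumberField K] {N : ℕ} [NeZero N] {W : WeierstrassCurve ℚ}
  {p : ℕ} [hp : Fact p.Prime] {κ : ZpExtension K p} {jbar : AlgebraicClosure K →+* ℂ}

omit [NumberField K] in
/-- The `Γ_K`-orbit maps of `E[m]` are continuous (discrete coefficients, open stabilisers). [folklore] -/
theorem continuous_smul_geomTorsion' (V : WeierstrassCurve K) (m : ℤ) (t : geomTorsion V m) :
    Continuous fun g : Field.absoluteGaloisGroup K ↦ g • t :=
  continuous_induced_rng.2 (by
    change Continuous fun g : Field.absoluteGaloisGroup K ↦ ((g • t : geomTorsion V m) : geomPoints V)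
    simp only [AddSubgroup.torsionBy.coe_smul]
    exact continuous_smul_of_isOpen_stabilizer (t : geomPoints V) (isOpen_stabilizer_point_holds V _))

/-- **K1 at layer `k` ⟹ the norm of the layer-`n` Kummer class is locally non-zero**, `n = k + m` (module docstring).
[cite: BertoliniDarmon1996, §2.5 eq. (7) (p. 435)] [cite: SilvermanAEC2009, VIII.§2] -/
theorem resOfLe_sum_conjH1_kummerClassOver_ne_zero (F : HeegnerFamily N W K κ jbar)
    {γ : Field.absoluteGaloisGroup K} {α : ℤ} (hα : α ^ 2 = 1) (hcoh : F.IsNormCompatible γ α)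
    (Dg : Subgroup (Field.absoluteGaloisGroup K)) (k m : ℕ)
    (h0 : ∀ t : geomTorsion (W.baseChange K) (p : ℤ),
      (∀ σ ∈ κ.layerSubgroup (k + m) ⊓ Dg, σ • t = t) → t = 0)
    (hK1 : ∀ (Q : geomPoints (W.baseChange K))
      (hQ : ∀ σ ∈ κ.layerSubgroup k ⊓ Dg, σ • ((p : ℤ) • Q) = (p : ℤ) • Q),
      (p : ℤ) • Q = F.z k → (W.baseChange K).kummerClassOver (κ.layerSubgroup k ⊓ Dg) p Q hQ ≠ 0)
    (Qn : geomPoints (W.baseChange K)) (hQn : (p : ℤ) • Qn = F.z (k + m))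
    (hQn' : ∀ σ ∈ κ.layerSubgroup (k + m), σ • ((p : ℤ) • Qn) = (p : ℤ) • Qn) :
    resOfLe (geomTorsion (W.baseChange K) (p : ℤ))
        (inf_le_left : κ.layerSubgroup (k + m) ⊓ Dg ≤ κ.layerSubgroup (k + m))
      (∑ i ∈ range (p ^ m), Literature.NumberTheory.EllipticCurves.conjH1 (κ.layerSubgroup (k + m))
        (geomTorsion (W.baseChange K) (p : ℤ)) (γ ^ (p ^ k * i))
        ((W.baseChange K).kummerClassOver (κ.layerSubgroup (k + m)) p Qn hQn')) ≠ 0 := by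
  have hp0 : (p : ℤ) ≠ 0 := by exact_mod_cast hp.out.ne_zero
  -- fixedness of the `p`-multiples of the conjugated roots
  have hfixγ : ∀ i : ℕ, ∀ σ ∈ κ.layerSubgroup (k + m),
      σ • ((p : ℤ) • (γ ^ (p ^ k * i)) • Qn) = (p : ℤ) • (γ ^ (p ^ k * i)) • Qn := by
    intro i σ hσ
    have hmem : (γ ^ (p ^ k * i))⁻¹ * σ * γ ^ (p ^ k * i) ∈ κ.layerSubgroup (k + m) :=
      (κ.layerSubgroup_normal (k + m)).conj_mem' σ hσ _
    rw [← smul_zsmul_geomPoints, ← mul_smul,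
      show σ * γ ^ (p ^ k * i) = γ ^ (p ^ k * i) * ((γ ^ (p ^ k * i))⁻¹ * σ * γ ^ (p ^ k * i)) by group,
      mul_smul, hQn' _ hmem]
  -- Step 1: conjugation of Kummer classes, then additivity
  have h1 : ∑ i ∈ range (p ^ m), Literature.NumberTheory.EllipticCurves.conjH1 (κ.layerSubgroup (k + m))
        (geomTorsion (W.baseChange K) (p : ℤ)) (γ ^ (p ^ k * i))
        ((W.baseChange K).kummerClassOver (κ.layerSubgroup (k + m)) p Qn hQn') =
      ∑ i ∈ range (p ^ m), (W.baseChange K).kummerClassOver (κ.layerSubgroup (k + m)) p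
        ((γ ^ (p ^ k * i)) • Qn) (hfixγ i) :=
    Finset.sum_congr rfl fun i _ ↦
      (W.baseChange K).conjH1_kummerClassOver (κ.layerSubgroup (k + m)) p (γ ^ (p ^ k * i)) Qn hQn'
  rw [h1, kummerClassOver_sum]
  -- Step 2: the `p`-multiple of the summed root is `α^m • z_k`
  have hsum : (p : ℤ) • ∑ i ∈ range (p ^ m), (γ ^ (p ^ k * i)) • Qn = α ^ m • F.z k := by
    rw [Finset.smul_sum]
    simp_rw [← smul_zsmul_geomPoints, hQn]
    exact sum_transversal_smul_z F hcoh k m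
  -- Step 3: a root of `z_k` and root independence
  obtain ⟨Qk, hQk⟩ := (W.baseChange K).zsmul_geomPoints_surjective_of_charZero hp0 (F.z k)
  dsimp only at hQk
  have hfixk : ∀ σ ∈ κ.layerSubgroup k ⊓ Dg, σ • ((p : ℤ) • Qk) = (p : ℤ) • Qk := fun σ hσ ↦ by
    rw [hQk]; exact (F.isHeegnerNormPoint_z k).smul_eq_self (inf_le_left (b := Dg) hσ)
  have hfixk' : ∀ σ ∈ κ.layerSubgroup k ⊓ Dg, σ • ((p : ℤ) • (α ^ m • Qk)) = (p : ℤ) • (α ^ m • Qk) :=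
    fun σ hσ ↦ by rw [smul_comm (p : ℤ), smul_zsmul_geomPoints, hfixk σ hσ]
  have hfixn' : ∀ σ ∈ κ.layerSubgroup (k + m), σ • ((p : ℤ) • (α ^ m • Qk)) = (p : ℤ) • (α ^ m • Qk) :=
    fun σ hσ ↦ by
      rw [smul_comm (p : ℤ), hQk, smul_zsmul_geomPoints,
        (F.isHeegnerNormPoint_z k).smul_eq_self (κ.layerSubgroup_antitone (Nat.le_add_right k m) hσ)]
  have heq : (p : ℤ) • ∑ i ∈ range (p ^ m), (γ ^ (p ^ k * i)) • Qn = (p : ℤ) • (α ^ m • Qk) := by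
    rw [hsum, smul_comm, hQk]
  rw [(W.baseChange K).kummerClassOver_eq_of_zsmul_eq (κ.layerSubgroup (k + m)) p _ (α ^ m • Qk) _ hfixn' heq]
  -- Step 4: restriction to `Γ_{K_n} ∩ D` factors through `Γ_{K_k} ∩ D`
  have hle : κ.layerSubgroup (k + m) ⊓ Dg ≤ κ.layerSubgroup k ⊓ Dg :=
    inf_le_inf_right Dg (κ.layerSubgroup_antitone (Nat.le_add_right k m))
  rw [(W.baseChange K).resOfLe_kummerClassOver,
    ← (W.baseChange K).resOfLe_kummerClassOver hle p (α ^ m • Qk) hfixk']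
  -- Step 5: the layer-`k` local class of `α^m • Q_k` is non-zero (K1 + sign trick)
  have hk0 : (W.baseChange K).kummerClassOver (κ.layerSubgroup k ⊓ Dg) p (α ^ m • Qk) hfixk' ≠ 0 :=
    kummerClassOver_ne_zero_of_zsmul_sq_eq_one (W.baseChange K) _ p hα m Qk _ hfixk hfixk'
      (hK1 Qk hfixk hQk) (by rw [smul_comm])
  -- Step 6: inflation–restriction: `res` is injective under (H0)
  have hN : ((κ.layerSubgroup (k + m) ⊓ Dg).subgroupOf (κ.layerSubgroup k ⊓ Dg)).Normal := by
    refine (Subgroup.normal_subgroupOf_iff hle).mpr fun x y hx hy ↦ ⟨?_, ?_⟩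
    · exact (κ.layerSubgroup_normal (k + m)).conj_mem x hx.1 y
    · exact Dg.mul_mem (Dg.mul_mem hy.2 hx.2) (Dg.inv_mem hy.2)
  have hinj := Summit.BirchSwinnertonDyer.Rank1Residual.X11b.AcSelmer.resOfLe_injective_of_fixedPoints hle hN
    (continuous_smul_geomTorsion' (W.baseChange K) p) h0
  exact fun h ↦ hk0 (hinj (by rw [h, map_zero]))

end Summit.BirchSwinnertonDyer.BirchSwinnertonDyer.Theorems.UniversalToricDescentHeegnerLayerSignature

end
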